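import Summits.BirchSwinnertonDyer.BirchSwinnertonDyer.Theorems.AlignedTransportAtTwoMainConjectureTransportAlignedAtTwoAddTwistHalfSums
import HarnessLib

/-!
# Route `AlignedTransportAtTwo`, crux C1 `MainConjectureTransportAlignedAtTwo` (stmt-BirchSwinnertonDyer-22296), line `birth` —
# the BOTH-ADDITIVE twist sub-cell, part 2 (TAME MEASURE): the character halves of the tame Mazur–Swinnerton-Dyer measure
# at a prime tame level `ℓ` with `ℓ² ∣ N`, `a_ℓ = 0`, are `½ℤ₂`-valued

HONEST FRAMING (cell `bsd-f1-sign2`, WIDTH-5 attach seat `bsd-line-att-p4` g9, under the lead `bsd-line-att-p1`). BSD is NOT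
proved; C1 is NOT closed. THEOREMS ONLY; nothing asserted; `--supports stmt-BirchSwinnertonDyer-22296 --as helper`. Sequel of
`…AddTwistCusp` / `…AddTwistHalfSums`.

For `E = W/ℚ` globally minimal, good ordinary at `2`, with `E[2]` irreducible, `f` its newform (level `N`), and an odd prime `ℓ`
with `ℓ² ∣ N` and `a_ℓ(f) = 0` (e.g. an ADDITIVE prime of `E`, `N = N_E`):
* §1 the tame fractions `c/(2ⁿℓ)` (`c ≡ a (2ⁿ)`, `c ≡ b (ℓ)`, `a` a unit) lie in the class `[2ⁿb/ℓ]`, `2·c/(2ⁿℓ)` in the class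
  `[2ⁿ⁻¹b/ℓ]` (`n ≥ 1`) / `[2b/ℓ]` (`n = 0`) (`…AddTwistCusp` §1–§2), so the character sums of tame symbols are half-character sums
  `Σ_{χ(b)=±1}[b/ℓ]⁺` up to `½ℤ` (`…AddTwistHalfSums`), hence of `2`-adic norm `≤ 2`;
* §2 `norm_sum_filter_msdMeasureTame_le_two` — **`‖Σ_{χ(b)=ε} μ_{f,α,ℓ}((a + 2ⁿℤ₂) × {b})‖₂ ≤ 2`** (`ε = ±1`, `a` a unit):
  the both-additive substitute for the termwise bound `norm_msdMeasureTame_two_le_two_sqfreeAt` (which needs `ℓ ∥ N`);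
* companion `…AddTwistCongruence` (§3–§4): the Riemann sums (`‖RS(χ)‖ ≤ 1`, `‖RS(𝟙_ℓ)‖ ≤ 1`, `‖RS(χ) − RS(𝟙_ℓ)‖ ≤ ‖2‖`),
  `L₂(f,α,χ) ≡ L₂(f,α,𝟙_ℓ) (mod 2Λ)`, the depletion `L₂(f,α,𝟙_ℓ) = −(1+T)^{f_ℓ}·L₂(f,α)` (`U_ℓ` with `a_ℓ = 0`), hence
  **`L₂(f,α,χ_ℓ) ≡ u·L₂(f,α) (mod 2Λ)` with NO Euler factor** — the analytic Kida step at `2` with ZERO local terms at a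
  both-additive prime.

References: [MazurTateTeitelbaum1986Invent] §I.4 (4.2), §I.8, §I.10–§I.13; [Matsuno2000] Lemmas 3.2–3.3, Thm. 3.1 (pp. 86–88);
[CremonaAlgorithms1997] §2.2, §2.8; [GreenbergVatsal2000] Prop. (3.7), §1 (8); [DarmonDiamondTaylor1995] Prop. 2.6(b).
-/

set_option autoImplicit false
set_option linter.dupNamespace false

noncomputable section

open scoped Classical MatrixGroups ModularForm

open CongruenceSubgroup Filter Topology PowerSeries
open Literature.NumberTheory.EllipticCurves Literature.NumberTheory.EllipticCurves.ModularForms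
open Literature.NumberTheory.EllipticCurves.GreenbergVatsal2000
open Summit.BirchSwinnertonDyer.BirchSwinnertonDyer.Theorems.AlignedTransportAtTwoAddTwistCusp
open Summit.BirchSwinnertonDyer.BirchSwinnertonDyer.Theorems.AlignedTransportAtTwoAddTwistHalfSums

namespace Summit.BirchSwinnertonDyer.BirchSwinnertonDyer.Theorems.AlignedTransportAtTwoAddTwistTame

/-! ## §1 Tame fractions at a prime tame level `ℓ` with `ℓ² ∣ N` -/

section TameFractions

variable {N : ℕ} [NeZero N] (f : CuspForm (Gamma0 N) 2) {ℓ : ℕ} [Fact ℓ.Prime]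

/-- **`[c/(2ᵏℓ)]⁺ = [2ᵏb/ℓ]⁺ + j/2` for `c ≡ b (mod ℓ)`, `ℓ² ∣ N`, `N` odd, and `c` odd unless `k = 0`** (`…AddTwistCusp` §2 with
`p = c`, `k = 2ᵏ`: `gcd(2ᵏ, cN) = 1`). [cite: CremonaAlgorithms1997, §2.2 Lemma 2.2.3 and §2.8] -/
theorem exists_ratPlusSymbol_div_pow_mul_eq (hreal : ∀ n, (cuspCoeff f n).im = 0)
    (hrat : ∀ r : ℚ, (ratPlusSymbol f r : ℝ) = normalizedPlusSymbol f r) (hℓN : ℓ ^ 2 ∣ N) (h2N : ¬ 2 ∣ N)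
    (k : ℕ) {c : ℤ} (hc : k = 0 ∨ ¬ (2 : ℤ) ∣ c) {b : ZMod ℓ} (hcb : (c : ZMod ℓ) = b) :
    ∃ j : ℤ, ratPlusSymbol f ((c : ℚ) / (2 ^ k * ℓ)) =
      ratPlusSymbol f ((((2 : ZMod ℓ) ^ k * b).val : ℚ) / ℓ) + (j : ℚ) / 2 := by
  have hℓ : ℓ.Prime := Fact.out
  obtain ⟨M', hM'⟩ := hℓN
  have hN : (N : ℤ) = (ℓ : ℤ) * ℓ * M' := by rw [hM']; push_cast; ring
  have hℓ0 : (ℓ : ℤ) ≠ 0 := by exact_mod_cast hℓ.ne_zero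
  have hk0 : ((2 : ℤ) ^ k) ≠ 0 := pow_ne_zero _ two_ne_zero
  -- `gcd(2ᵏ, c ℓ M') = 1`
  have hcop : IsCoprime ((2 : ℤ) ^ k) (c * ((ℓ : ℤ) * M')) := by
    rcases hc with rfl | hc
    · rw [pow_zero]; exact isCoprime_one_left
    · refine IsCoprime.pow_left ((Prime.coprime_iff_not_dvd Int.prime_two).mpr fun h ↦ ?_)
      have hN2 : ¬ (2 : ℤ) ∣ (ℓ : ℤ) * M' := by
        intro h'
        apply h2N
        have h'' : (2 : ℤ) ∣ (N : ℤ) := by rw [hN, mul_assoc]; exact h'.mul_left _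
        exact_mod_cast h''
      rcases Int.prime_two.dvd_or_dvd h with h1 | h1
      · exact hc h1
      · exact hN2 h1
  obtain ⟨j, hj⟩ := exists_ratPlusSymbol_div_mul_eq_add_div_two f hreal hrat hN hℓ0 hk0 hcop (p := c)
  refine ⟨j, ?_⟩
  have hcl : (((2 : ℤ) ^ k * c : ℤ) : ZMod ℓ) = ((((2 : ZMod ℓ) ^ k * b).val : ℤ) : ZMod ℓ) := by
    push_cast
    rw [ZMod.natCast_zmod_val, hcb]
  have h := ratPlusSymbol_div_eq_of_intCast_eq f hℓ.ne_zero hcl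
  push_cast at hj h ⊢
  rw [hj, h]

/-- The Chinese-remainder representative of `(a mod 2ⁿ, b mod ℓ)` is ODD when `n ≥ 1` and `a` is a unit. [folklore] -/
theorem not_two_dvd_tameRep {n : ℕ} (hn : n ≠ 0) {a : ZMod (2 ^ n)} (ha : IsUnit a) (b : ZMod ℓ) (hℓ2 : ℓ.Coprime 2) :
    ¬ (2 : ℤ) ∣ (tameRep 2 ℓ n a b : ℤ) := by
  have h := natCast_tameRep_left (m := ℓ) (n := n) Nat.prime_two hℓ2 a b
  have hu : IsUnit ((tameRep 2 ℓ n a b : ℕ) : ZMod (2 ^ n)) := by rw [h]; exact ha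
  have hcop := (ZMod.isUnit_iff_coprime _ _).mp hu
  intro h2
  have h2' : 2 ∣ tameRep 2 ℓ n a b := by exact_mod_cast h2
  have h1 : Nat.Coprime 2 2 :=
    Nat.Coprime.coprime_dvd_left h2' (Nat.Coprime.coprime_dvd_right (dvd_pow_self 2 hn) hcop)
  norm_num at h1

/-- **The tame fraction `c/(2ⁿℓ)` lies in the class `[2ⁿb/ℓ]`**: `[c/(2ⁿℓ)]⁺ = [2ⁿb/ℓ]⁺ + j/2` (`a` a unit mod `2ⁿ`, `ℓ² ∣ N`, `N` odd).
[cite: MazurTateTeitelbaum1986Invent, §I.10 (10.1)] [cite: CremonaAlgorithms1997, §2.2 Lemma 2.2.3] -/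
theorem exists_ratPlusSymbol_tameFraction_eq (hreal : ∀ n, (cuspCoeff f n).im = 0)
    (hrat : ∀ r : ℚ, (ratPlusSymbol f r : ℝ) = normalizedPlusSymbol f r) (hℓN : ℓ ^ 2 ∣ N) (h2N : ¬ 2 ∣ N)
    (hℓ2 : ℓ.Coprime 2) (n : ℕ) {a : ZMod (2 ^ n)} (ha : IsUnit a) (b : ZMod ℓ) :
    ∃ j : ℤ, ratPlusSymbol f (tameFraction 2 ℓ n a b) =
      ratPlusSymbol f ((((2 : ZMod ℓ) ^ n * b).val : ℚ) / ℓ) + (j : ℚ) / 2 := by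
  have hc : n = 0 ∨ ¬ (2 : ℤ) ∣ (tameRep 2 ℓ n a b : ℤ) := by
    by_cases hn : n = 0
    · exact Or.inl hn
    · exact Or.inr (not_two_dvd_tameRep hn ha b hℓ2)
  have hcb : ((tameRep 2 ℓ n a b : ℤ) : ZMod ℓ) = b := by
    rw [Int.cast_natCast, natCast_tameRep_right hℓ2]
  obtain ⟨j, hj⟩ := exists_ratPlusSymbol_div_pow_mul_eq f hreal hrat hℓN h2N n hc hcb
  refine ⟨j, ?_⟩
  have hx : tameFraction 2 ℓ n a b = ((tameRep 2 ℓ n a b : ℤ) : ℚ) / (2 ^ n * ℓ) := by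
    unfold tameFraction; push_cast; rfl
  rw [hx, hj]

/-- **`2 ·` the tame fraction lies in the class `[2ⁿ⁻¹b/ℓ]` (`n ≥ 1`)**: `[2·c/(2ⁿ⁺¹ℓ)]⁺ = [2ⁿb/ℓ]⁺ + j/2`.
[cite: MazurTateTeitelbaum1986Invent, §I.10 (10.1)] [cite: CremonaAlgorithms1997, §2.2 Lemma 2.2.3] -/
theorem exists_ratPlusSymbol_two_mul_tameFraction_succ_eq (hreal : ∀ n, (cuspCoeff f n).im = 0)
    (hrat : ∀ r : ℚ, (ratPlusSymbol f r : ℝ) = normalizedPlusSymbol f r) (hℓN : ℓ ^ 2 ∣ N) (h2N : ¬ 2 ∣ N)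
    (hℓ2 : ℓ.Coprime 2) (n : ℕ) {a : ZMod (2 ^ (n + 1))} (ha : IsUnit a) (b : ZMod ℓ) :
    ∃ j : ℤ, ratPlusSymbol f (((2 : ℕ) : ℚ) * tameFraction 2 ℓ (n + 1) a b) =
      ratPlusSymbol f ((((2 : ZMod ℓ) ^ n * b).val : ℚ) / ℓ) + (j : ℚ) / 2 := by
  have hc : n = 0 ∨ ¬ (2 : ℤ) ∣ (tameRep 2 ℓ (n + 1) a b : ℤ) :=
    Or.inr (not_two_dvd_tameRep (Nat.succ_ne_zero n) ha b hℓ2)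
  have hcb : ((tameRep 2 ℓ (n + 1) a b : ℤ) : ZMod ℓ) = b := by
    rw [Int.cast_natCast, natCast_tameRep_right hℓ2]
  obtain ⟨j, hj⟩ := exists_ratPlusSymbol_div_pow_mul_eq f hreal hrat hℓN h2N n hc hcb
  refine ⟨j, ?_⟩
  have hℓQ : (ℓ : ℚ) ≠ 0 := by exact_mod_cast (Fact.out : ℓ.Prime).ne_zero
  have hx : ((2 : ℕ) : ℚ) * tameFraction 2 ℓ (n + 1) a b = ((tameRep 2 ℓ (n + 1) a b : ℤ) : ℚ) / (2 ^ n * ℓ) := by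
    unfold tameFraction; push_cast; field_simp; ring
  rw [hx, hj]

/-- **`2 ·` the tame fraction at `n = 0` lies in the class `[2b/ℓ]`**: `[2·c/ℓ]⁺ = [2b/ℓ]⁺` (translation only).
[cite: MazurTateTeitelbaum1986Invent, §I.10 (10.1)] -/
theorem ratPlusSymbol_two_mul_tameFraction_zero_eq (hℓ2 : ℓ.Coprime 2) (a : ZMod (2 ^ 0)) (b : ZMod ℓ) :
    ratPlusSymbol f (((2 : ℕ) : ℚ) * tameFraction 2 ℓ 0 a b) = ratPlusSymbol f ((((2 : ZMod ℓ) * b).val : ℚ) / ℓ) := by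
  have hℓ : ℓ.Prime := Fact.out
  have hcb : ((tameRep 2 ℓ 0 a b : ℤ) : ZMod ℓ) = b := by
    rw [Int.cast_natCast, natCast_tameRep_right hℓ2]
  have hcl : ((2 * (tameRep 2 ℓ 0 a b : ℤ) : ℤ) : ZMod ℓ) = ((((2 : ZMod ℓ) * b).val : ℤ) : ZMod ℓ) := by
    push_cast at hcb ⊢
    rw [ZMod.natCast_zmod_val, hcb]
  have h := ratPlusSymbol_div_eq_of_intCast_eq f hℓ.ne_zero hcl
  have hx : ((2 : ℕ) : ℚ) * tameFraction 2 ℓ 0 a b = ((2 * (tameRep 2 ℓ 0 a b : ℤ) : ℤ) : ℚ) / ℓ := by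
    unfold tameFraction; push_cast; ring
  rw [hx, h]
  push_cast
  rfl

end TameFractions

/-! ## §2 Character sums of tame symbols and the bound `‖Σ_{χ(b)=ε} μ_{f,α,ℓ}‖₂ ≤ 2` -/

section Sums

variable {N : ℕ} [NeZero N] (f : CuspForm (Gamma0 N) 2) {ℓ : ℕ} [Fact ℓ.Prime]

omit [NeZero N] in
/-- Reindexing a character-class sum along multiplication by a unit `u`: `Σ_{χ(b)=ε} g(ub) = Σ_{χ(b)=χ(u)ε} g(b)`
(`χ(u⁻¹) = χ(u) = ±1`). [folklore] -/
theorem sum_filter_mul_eq {M : Type*} [AddCommMonoid M] (χ : MulChar (ZMod ℓ) ℤ) {u : ZMod ℓ} (hu : u ≠ 0)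
    (g : ZMod ℓ → M) (ε : ℤ) :
    ∑ b ∈ Finset.univ.filter (fun b : ZMod ℓ ↦ χ b = ε), g (u * b) =
      ∑ b ∈ Finset.univ.filter (fun b : ZMod ℓ ↦ χ b = χ u * ε), g b := by
  have hδu : χ u = 1 ∨ χ u = -1 := mulChar_apply_eq_one_or_eq_neg_one χ hu
  have hδsq : χ u * χ u = 1 := by rcases hδu with h | h <;> rw [h] <;> norm_num
  have hχinv : χ u⁻¹ = χ u := by
    have h1 : χ u⁻¹ * χ u = 1 := by rw [← map_mul, inv_mul_cancel₀ hu, map_one]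
    rcases hδu with h | h <;> rw [h] at h1 ⊢ <;> linarith
  refine Finset.sum_nbij' (fun b ↦ u * b) (fun b ↦ u⁻¹ * b) ?_ ?_ ?_ ?_ ?_
  · intro b hb
    simp only [Finset.mem_filter, Finset.mem_univ, true_and] at hb ⊢
    rw [map_mul, hb]
  · intro b hb
    simp only [Finset.mem_filter, Finset.mem_univ, true_and] at hb ⊢
    rw [map_mul, hχinv, hb, ← mul_assoc, hδsq, one_mul]
  · intro b _; simp only [inv_mul_cancel_left₀ hu]
  · intro b _; simp only [mul_inv_cancel_left₀ hu]
  · intro b _; rfl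

/-- `2` is a unit mod the odd prime `ℓ`; private helper. [folklore] -/
private theorem two_ne_zero_zmod (hℓ2 : ℓ.Coprime 2) : (2 : ZMod ℓ) ≠ 0 := by
  have hℓ : ℓ.Prime := Fact.out
  have h : ((2 : ℕ) : ZMod ℓ) ≠ 0 := by
    rw [Ne, ZMod.natCast_eq_zero_iff]
    intro h
    have h2 : ℓ = 2 := le_antisymm (Nat.le_of_dvd two_pos h) hℓ.two_le
    rw [h2] at hℓ2
    norm_num at hℓ2
  exact_mod_cast h

/-- **The character sums of the tame symbols are half-character sums up to `½ℤ`**: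
`Σ_{χ(b)=ε} [c_b/(2ⁿℓ)]⁺ = Σ_{χ(b)=χ(2)ⁿε} [b/ℓ]⁺ + j/2` (`a` a unit mod `2ⁿ`). [cite: MazurTateTeitelbaum1986Invent, §I.10 (10.1)]
[cite: CremonaAlgorithms1997, §2.2 Lemma 2.2.3] -/
theorem exists_sum_filter_ratPlusSymbol_tameFraction_eq (hreal : ∀ n, (cuspCoeff f n).im = 0)
    (hrat : ∀ r : ℚ, (ratPlusSymbol f r : ℝ) = normalizedPlusSymbol f r) (hℓN : ℓ ^ 2 ∣ N) (h2N : ¬ 2 ∣ N)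
    (hℓ2 : ℓ.Coprime 2) (χ : MulChar (ZMod ℓ) ℤ) (ε : ℤ) (n : ℕ) {a : ZMod (2 ^ n)} (ha : IsUnit a) :
    ∃ j : ℤ, ∑ b ∈ Finset.univ.filter (fun b : ZMod ℓ ↦ χ b = ε), ratPlusSymbol f (tameFraction 2 ℓ n a b) =
      ∑ b ∈ Finset.univ.filter (fun b : ZMod ℓ ↦ χ b = χ ((2 : ZMod ℓ) ^ n) * ε), ratPlusSymbol f ((b.val : ℚ) / ℓ) +
        (j : ℚ) / 2 := by
  obtain ⟨j, hj⟩ := exists_sum_eq_sum_add_div_two (Finset.univ.filter (fun b : ZMod ℓ ↦ χ b = ε))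
    (g := fun b ↦ ratPlusSymbol f (tameFraction 2 ℓ n a b))
    (h := fun b ↦ ratPlusSymbol f (((((2 : ZMod ℓ) ^ n * b).val : ℚ) / ℓ)))
    (fun b _ ↦ exists_ratPlusSymbol_tameFraction_eq f hreal hrat hℓN h2N hℓ2 n ha b)
  refine ⟨j, ?_⟩
  rw [hj, sum_filter_mul_eq χ (pow_ne_zero _ (two_ne_zero_zmod hℓ2)) (fun b ↦ ratPlusSymbol f ((b.val : ℚ) / ℓ)) ε]

/-- The same for `2·c_b/(2ⁿ⁺¹ℓ)`: `Σ_{χ(b)=ε} [2c_b/(2ⁿ⁺¹ℓ)]⁺ = Σ_{χ(b)=χ(2)ⁿε} [b/ℓ]⁺ + j/2`.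
[cite: MazurTateTeitelbaum1986Invent, §I.10 (10.1)] [cite: CremonaAlgorithms1997, §2.2 Lemma 2.2.3] -/
theorem exists_sum_filter_ratPlusSymbol_two_mul_tameFraction_succ_eq (hreal : ∀ n, (cuspCoeff f n).im = 0)
    (hrat : ∀ r : ℚ, (ratPlusSymbol f r : ℝ) = normalizedPlusSymbol f r) (hℓN : ℓ ^ 2 ∣ N) (h2N : ¬ 2 ∣ N)
    (hℓ2 : ℓ.Coprime 2) (χ : MulChar (ZMod ℓ) ℤ) (ε : ℤ) (n : ℕ) {a : ZMod (2 ^ (n + 1))} (ha : IsUnit a) :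
    ∃ j : ℤ, ∑ b ∈ Finset.univ.filter (fun b : ZMod ℓ ↦ χ b = ε),
        ratPlusSymbol f (((2 : ℕ) : ℚ) * tameFraction 2 ℓ (n + 1) a b) =
      ∑ b ∈ Finset.univ.filter (fun b : ZMod ℓ ↦ χ b = χ ((2 : ZMod ℓ) ^ n) * ε), ratPlusSymbol f ((b.val : ℚ) / ℓ) +
        (j : ℚ) / 2 := by
  obtain ⟨j, hj⟩ := exists_sum_eq_sum_add_div_two (Finset.univ.filter (fun b : ZMod ℓ ↦ χ b = ε))
    (g := fun b ↦ ratPlusSymbol f (((2 : ℕ) : ℚ) * tameFraction 2 ℓ (n + 1) a b))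
    (h := fun b ↦ ratPlusSymbol f (((((2 : ZMod ℓ) ^ n * b).val : ℚ) / ℓ)))
    (fun b _ ↦ exists_ratPlusSymbol_two_mul_tameFraction_succ_eq f hreal hrat hℓN h2N hℓ2 n ha b)
  refine ⟨j, ?_⟩
  rw [hj, sum_filter_mul_eq χ (pow_ne_zero _ (two_ne_zero_zmod hℓ2)) (fun b ↦ ratPlusSymbol f ((b.val : ℚ) / ℓ)) ε]

/-- The same at `n = 0`: `Σ_{χ(b)=ε} [2c_b/ℓ]⁺ = Σ_{χ(b)=χ(2)ε} [b/ℓ]⁺` exactly. [cite: MazurTateTeitelbaum1986Invent, §I.10 (10.1)] -/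
theorem sum_filter_ratPlusSymbol_two_mul_tameFraction_zero_eq (hℓ2 : ℓ.Coprime 2) (χ : MulChar (ZMod ℓ) ℤ) (ε : ℤ)
    (a : ZMod (2 ^ 0)) :
    ∑ b ∈ Finset.univ.filter (fun b : ZMod ℓ ↦ χ b = ε), ratPlusSymbol f (((2 : ℕ) : ℚ) * tameFraction 2 ℓ 0 a b) =
      ∑ b ∈ Finset.univ.filter (fun b : ZMod ℓ ↦ χ b = χ (2 : ZMod ℓ) * ε), ratPlusSymbol f ((b.val : ℚ) / ℓ) := by
  rw [← sum_filter_mul_eq χ (two_ne_zero_zmod hℓ2) (fun b ↦ ratPlusSymbol f ((b.val : ℚ) / ℓ)) ε]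
  exact Finset.sum_congr rfl fun b _ ↦ ratPlusSymbol_two_mul_tameFraction_zero_eq f hℓ2 a b

/-- **`‖Σ_{χ(b)=δ} [b/ℓ]⁺ + j/2‖₂ ≤ 2` for `δ = χ(u)·ε`, `ε = ±1`, `u` a unit** (the half-character sums are `j/(2n₁)` with `n₁` odd,
`…AddTwistHalfSums`). [cite: MazurTateTeitelbaum1986Invent, §I.8 and §I.10] -/
theorem norm_ratCast_sum_filter_add_le_two (hf : IsNewform0 f) (hreal : ∀ n, (cuspCoeff f n).im = 0)
    (hrat : ∀ r : ℚ, (ratPlusSymbol f r : ℝ) = normalizedPlusSymbol f r)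
    (hℓN : ℓ ^ 2 ∣ N) (haℓ : cuspCoeff f ℓ = 0) {q : ℕ} [Fact q.Prime] (hqN : ¬ q ∣ N) {aq : ℤ}
    (haq : cuspCoeff f q = aq) (hodd : ¬ (2 : ℤ) ∣ aq - q - 1) (χ : MulChar (ZMod ℓ) ℤ) {u : ZMod ℓ} (hu : u ≠ 0)
    {ε : ℤ} (hε : ε = 1 ∨ ε = -1) {x : ℚ} {j : ℤ}
    (hx : x = ∑ b ∈ Finset.univ.filter (fun b : ZMod ℓ ↦ χ b = χ u * ε), ratPlusSymbol f ((b.val : ℚ) / ℓ) +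
      (j : ℚ) / 2) :
    ‖((x : ℚ) : ℚ_[2])‖ ≤ 2 := by
  have hδ : χ u * ε = 1 ∨ χ u * ε = -1 := by
    rcases mulChar_apply_eq_one_or_eq_neg_one χ hu with h | h <;> rcases hε with h' | h' <;>
      simp [h, h']
  obtain ⟨n₁, j₁, hn₁, hS⟩ :=
    exists_sum_filter_ratPlusSymbol_div_eq_div_two_mul f hf hreal hrat hℓN haℓ hqN haq hodd χ hδ
  refine norm_ratCast_le_two_of_eq_div_two_mul (n₁ := n₁) (j := j₁ + j * n₁) hn₁ ?_
  have hn₁Q : (n₁ : ℚ) ≠ 0 := by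
    have : n₁ ≠ 0 := by rintro rfl; exact hn₁ (dvd_zero 2)
    exact_mod_cast this
  rw [hx, hS]
  push_cast
  field_simp

variable {W : WeierstrassCurve ℚ} [W.IsElliptic] [W.IsGloballyMinimal]

/-- **`‖Σ_{χ(b)=ε} μ_{f,α,ℓ}((a + 2ⁿℤ₂) × {b})‖₂ ≤ 2`** for the newform `f` (level `N`, `ℓ² ∣ N`, `a_ℓ(f) = 0`) of `E = W`
good ordinary at `2` (`α` the unit root), a character `χ` mod `ℓ` with values in `ℤ`, `ε = ±1`, `a` a UNIT mod `2ⁿ`, given one odd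
prime `q ∤ N` with `a_q − q − 1` odd: `Σ_{χ=ε} μ = α⁻ⁿ·Σ_{χ=ε}[x_b]⁺ − α⁻ⁿ⁻¹·Σ_{χ=ε}[2x_b]⁺` and both sums are half-character sums
up to `½ℤ`. The both-additive substitute for `norm_msdMeasureTame_two_le_two_sqfreeAt`. [cite: MazurTateTeitelbaum1986Invent, §I.10 (10.1)]
[cite: Matsuno2000, Lemma 3.2 (p. 87)] -/
theorem norm_sum_filter_msdMeasureTame_le_two (hord : IsOrdinaryAt W 2) (hf : IsNewformOf W f)
    (hℓN : ℓ ^ 2 ∣ N) (haℓ : cuspCoeff f ℓ = 0) {q : ℕ} [Fact q.Prime] (hqN : ¬ q ∣ N) {aq : ℤ}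
    (haq : cuspCoeff f q = aq) (hodd : ¬ (2 : ℤ) ∣ aq - q - 1) (χ : MulChar (ZMod ℓ) ℤ) {ε : ℤ}
    (hε : ε = 1 ∨ ε = -1) (n : ℕ) {a : ZMod (2 ^ n)} (ha : IsUnit a) :
    ‖∑ b ∈ Finset.univ.filter (fun b : ZMod ℓ ↦ χ b = ε), msdMeasureTame f ℓ (unitRoot W 2 : ℚ_[2]) n a b‖ ≤ 2 := by
  have hℓ : ℓ.Prime := Fact.out
  have h2N : ¬ 2 ∣ N := not_dvd_level_of_isNewformOf hf hord.1
  have hℓ2 : ℓ.Coprime 2 := (Nat.coprime_primes hℓ Nat.prime_two).mpr (by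
    rintro rfl; exact h2N ((dvd_pow_self 2 two_ne_zero).trans hℓN))
  have hreal : ∀ n, (cuspCoeff f n).im = 0 := cuspCoeff_im_eq_zero_of_coeffField_eq_bot hf.coeffField_eq_bot
  have hrat := ratCast_ratPlusSymbol_of_maninDrinfeld
    (exists_nsmul_modularSymbol_mem_periodLattice_of_isNewform0 hf.1 hf.coeffField_eq_bot)
  obtain ⟨-, hαu, -⟩ := unitRoot_coe_spec (W := W) hord
  set α : ℚ_[2] := (unitRoot W 2 : ℚ_[2]) with hα
  have hαi : ∀ k : ℕ, ‖α⁻¹ ^ k‖ ≤ 1 := fun k ↦ by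
    rw [norm_pow, norm_inv, hαu, inv_one, one_pow]
  have h20 : (2 : ZMod ℓ) ≠ 0 := two_ne_zero_zmod hℓ2
  set B := Finset.univ.filter (fun b : ZMod ℓ ↦ χ b = ε) with hB
  -- split the measure into its two symbol sums
  have hsplit : ∑ b ∈ B, msdMeasureTame f ℓ α n a b =
      α⁻¹ ^ n * (((∑ b ∈ B, ratPlusSymbol f (tameFraction 2 ℓ n a b) : ℚ)) : ℚ_[2]) -
        α⁻¹ ^ (n + 1) * (((∑ b ∈ B, ratPlusSymbol f (((2 : ℕ) : ℚ) * tameFraction 2 ℓ n a b) : ℚ)) : ℚ_[2]) := by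
    simp only [msdMeasureTame]
    rw [Finset.sum_sub_distrib, Rat.cast_sum, Rat.cast_sum, Finset.mul_sum, Finset.mul_sum]
  rw [hsplit]
  -- the two symbol sums have norm `≤ 2`
  have hA : ‖(((∑ b ∈ B, ratPlusSymbol f (tameFraction 2 ℓ n a b) : ℚ)) : ℚ_[2])‖ ≤ 2 := by
    obtain ⟨j, hj⟩ := exists_sum_filter_ratPlusSymbol_tameFraction_eq f hreal hrat hℓN h2N hℓ2 χ ε n ha
    exact norm_ratCast_sum_filter_add_le_two f hf.1 hreal hrat hℓN haℓ hqN haq hodd χ (pow_ne_zero _ h20) hε hj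
  have hB' : ‖(((∑ b ∈ B, ratPlusSymbol f (((2 : ℕ) : ℚ) * tameFraction 2 ℓ n a b) : ℚ)) : ℚ_[2])‖ ≤ 2 := by
    cases n with
    | zero =>
      have h := sum_filter_ratPlusSymbol_two_mul_tameFraction_zero_eq f hℓ2 χ ε a
      exact norm_ratCast_sum_filter_add_le_two f hf.1 hreal hrat hℓN haℓ hqN haq hodd χ h20 hε (j := 0)
        (by rw [h]; simp)
    | succ n =>
      obtain ⟨j, hj⟩ := exists_sum_filter_ratPlusSymbol_two_mul_tameFraction_succ_eq f hreal hrat hℓN h2N hℓ2 χ ε n ha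
      exact norm_ratCast_sum_filter_add_le_two f hf.1 hreal hrat hℓN haℓ hqN haq hodd χ (pow_ne_zero _ h20) hε hj
  have h1 : ‖α⁻¹ ^ n * (((∑ b ∈ B, ratPlusSymbol f (tameFraction 2 ℓ n a b) : ℚ)) : ℚ_[2])‖ ≤ 2 := by
    rw [norm_mul]
    calc _ ≤ (1 : ℝ) * 2 := mul_le_mul (hαi n) hA (norm_nonneg _) zero_le_one
      _ = 2 := one_mul _
  have h2 : ‖α⁻¹ ^ (n + 1) *
      (((∑ b ∈ B, ratPlusSymbol f (((2 : ℕ) : ℚ) * tameFraction 2 ℓ n a b) : ℚ)) : ℚ_[2])‖ ≤ 2 := by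
    rw [norm_mul]
    calc _ ≤ (1 : ℝ) * 2 := mul_le_mul (hαi (n + 1)) hB' (norm_nonneg _) zero_le_one
      _ = 2 := one_mul _
  rw [sub_eq_add_neg]
  refine (Padic.nonarchimedean _ _).trans (max_le h1 ?_)
  rw [norm_neg]
  exact h2

end Sums

end Summit.BirchSwinnertonDyer.BirchSwinnertonDyer.Theorems.AlignedTransportAtTwoAddTwistTame

end
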